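import Literature.MathematicalPhysics.QuantumFieldTheory.Balaban1983to89.B9Thm311SmallFieldCoercivityTowerL2
import Literature.MathematicalPhysics.QuantumFieldTheory.Balaban1983to89.B9Eq319QprimeTowerNeumannSection

/-!
# `Balaban1983to89.B9Thm311SmallFieldCoercivityTowerL2Sections` — T. Bałaban, *Propagators for lattice gauge theories in a background field*, Commun.
# Math. Phys. **99** (1985) 389–434 [Balaban1985BackgroundPropagators] Thm 3.11 p. 416 with (3.82)–(3.86) p. 407 and (3.19) p. 393, AT `k = n+1`
# AVERAGING LEVELS: **`B9Thm311SmallFieldCoercivityTowerL2` WITH THE TWO SECTIONS OF `Q′_k` AND THEIR `L²` LETTER DISCHARGED, VOLUME-FREE** —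
# `S₁ := S♭_k` (`B9Eq319QprimeTowerFlatSection`), `S₂ := S♭_k(1 + E)⁻¹` (`B9Eq319QprimeTowerNeumannSection`), `ρ := ρ̂(1 − ρ̂)⁻¹`,
# `ρ̂ := Π_{j<k}(1 + 2M_φM_φ′ε_j)^{d(L−1)} − 1` (`B9Eq319QprimeTowerLipschitzL2`): only `ε`, `δ_Q`, `hRS` (or unitarity) remain displayed

statement-level skeleton of published theorems with citation tags; proofs where landed; nothing here is a claim about the Yang–Mills mass gap

PDF held: `paper:balaban1985-cmp99-background-propagators` (journal page = PDF page + 388) pp. 393, 407, 416 (text layer read by this seat 2026-08-22).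
THE PRINT (verbatim, p. 416): *«Theorem 3.11. Under the assumptions of the Theorems 3.1–3.10 (i.e. for M sufficiently large and α₀ sufficiently small) the
operators Δ′_a, G′, (Q′G′²Q′*)⁻¹, Δ_a, G are positive definite.»*  Print uses only «Q′ onto»; right inverses of `Q′_k(1)`, `Q′_k(U)` are the cell's device.

WHY THIS FILE (cell context; NE9 crux team, leaf-02's ASK (d) and OFFER O-3 (a)(b)(c), the row OWNER's INTENT I-ne9p1-g85-5).  The host
`B9Thm311SmallFieldCoercivityTowerL2.exists_coercive_principalk_of_small_field_L2` re-typed the sections of `Q′_k` in the `L²` currency and DISPLAYS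
`(S₁, S₂, ρ)`: right inverses `S₁` of `Q′_k(1)`, `S₂` of `Q′_k(U)` with `‖S₁(Q′_k(1)λ − Q′_k(U)λ)‖ ≤ ρ‖λ‖`, `‖S₂(Q′_k(U)λ − Q′_k(1)λ)‖ ≤ ρ‖λ‖`.  This file
INHABITS that display by name: `S₁` = the block-constant flat section (`‖S₁h‖² = c₀L^{kd}Σ_y‖h y‖²`), `S₂` = the Neumann section of `Q′_k(U)`
(`‖S₂h‖ ≤ √(c₀L^{kd})(1 − ρ̂)⁻¹√Σ‖h y‖²`), both letters from the `ℓ²` tower letter `√Σ_y‖(Q′_k(U)λ − Q′_k(1)λ)(y)‖² ≤ ρ̂·√((c₀L^{kd})⁻¹)·‖λ‖` — the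
factors `√(c₀L^{kd})·√((c₀L^{kd})⁻¹) = 1` cancel EXACTLY, so `ρ = ρ̂(1 − ρ̂)⁻¹` carries NO volume and NO `L^{kd}` (the sup-currency host had
`CS·ρ′ ∝ L^{kd}√#T_m`).  What remains displayed: the fine bond smallness `ε`, the level bond smallness `ε_j` (through `ρ̂`), `δ_Q` (inhabited level-free by
`B9Eq315QTowerLipschitzL2`), `hRS` (or unitarity + a tracial `τ`), and the tower's `hU1 ∕ hreg`.

WHAT IS PROVED (sorry-free; proof lane — no `def`, no `Prop` placeholder, no inequality of the paper asserted).
* §1 **`exists_coercive_principalk_of_small_field_L2_sections`** — the host's `γ, ε₀` (unchanged); for EVERY `U` with the tower data, level bond variables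
  `ε_j`-close to `1` in `U1`, `ρ̂ < 1`, `ε + ρ̂(1−ρ̂)⁻¹ + δ_Q ≤ ε₀`, `hRS`, the `Q`-letter: `γ‖x‖² ≤ re⟨x, (D*D + DR_k(U)D* + aQ_k(U)†Q_k(U))x⟩`.
* §2 **`laplaceAk_pos_of_small_field_L2_sections`**, **`laplaceAk_pos_of_small_field_unitary_L2_sections`** — the host's §2 likewise:
  `0 < re⟨x, Δ_a^{(k)}(U)x⟩` for `x ≠ 0`, the sections discharged.
HONEST RIDER (the host's, unchanged).  `ε₀` is the host's finite-lattice number — NOT level-free (Kato-gap remainder `∝ ‖η⁻¹‖²∕μ`); this file removes the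
sections and the coarse volume from the display, nothing else.  MODEL ∕ DECLARED READINGS as the host (M1)–(M6); `W` finite-dimensional.
HONEST SCOPE.  [folklore] junction of landed files; nothing of [B9] Thms 3.1–3.13 asserted; NOT summit progress (cell pub-balaban: NE9 NOT PRINTED ∕ NOT
PROVED, «NE9 ⇐ the named binders»; row WALLED ON A MODEL; spine PROVED 0∕9; rung (B)+1 finite T⁴ — NOT infinite volume, NOT mass gap, NOT Clay; HONEST
DEPENDENCY: continuum YM on T⁴ ⇐ BetaPertH ∧ nine spine estimates (0/9 proved); BetaPertH ⇐ (D1) ∧ (D4) ∧ CAP+tail; G-an2-4 gates asym, D1 and NE2/3/4).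
Filed by the NE9 crux-team leaf seat `b2b-balaban-t4-ne9-formalise-leaf-02` (gen 64); NEW file importing the row OWNER's `B9Thm311SmallFieldCoercivityTowerL2`
and this lineage's `B9Eq319QprimeTowerNeumannSection`; nothing modified.  Net new unproved facts: 0.
-/

noncomputable section

open scoped InnerProductSpace ComplexConjugate BigOperators

namespace Literature.MathematicalPhysics.QuantumFieldTheory.Balaban1983to89.B9Thm311SmallFieldCoercivityTowerL2Sections

open B4Sect5Torus (TSite)
open B9SectCLatticeCarrier (Bond)
open B7Prop1Explicit (U1 Wcx boxVec)
open B11Eq103H1Complex (SiteL2K BondL2K laplaceALatticeK)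
open B9Eq310HessianOperator (adTransportW principalOpK)
open B9Eq315QTorus (perCfg cornerSite)
open B9Eq315QTower (towerP UlevOf)
open B9Eq315QTowerFlat (perCfg_UlevOf_one_mem_U1 norm_Wcx_UlevOf_one_sub_one_le)
open B9Eq326OperatorTower (QprimeTowerW QkW RofUk laplaceAk)
open B9Eq319QprimeTowerLipschitzL2 (sqrt_sum_norm_sq_QprimeTowerW_sub_flat_le)
open B9Eq319QprimeTowerFlatSection (exists_QprimeTowerW_one_flatSection)
open B9Eq319QprimeTowerNeumannSection (exists_QprimeTowerW_section_of_small)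
open B9Thm311SmallFieldCoercivityTowerL2 (exists_coercive_principalk_of_small_field_L2 laplaceAk_pos_of_small_field_L2
  laplaceAk_pos_of_small_field_unitary_L2)

variable {d : ℕ} (L : ℕ) [NeZero L] (m : Fin d → ℕ) [∀ i, NeZero (m i)] (n : ℕ) (hL : 1 ≤ L)
  {𝔸 : Type*} [NormedRing 𝔸] [NormedAlgebra ℂ 𝔸] [CompleteSpace 𝔸] [NormOneClass 𝔸]
  {W : Type*} [NormedAddCommGroup W] [InnerProductSpace ℂ W] [FiniteDimensional ℂ W] (φ : W ≃ₗ[ℂ] 𝔸) {c₀ c₁ : ℝ} [Fact (0 < c₀)] [Fact (0 < c₁)]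

/-! ## §0 The two sections and their one `L²` letter `ρ = ρ̂(1 − ρ̂)⁻¹` (the junction, once) -/

section Sections

/-- arithmetic of the two section letters: `√A · (c · (√(A⁻¹) · t)) = c · t` for `0 < A`. [folklore] -/
private theorem sqrt_mul_sqrt_inv_mul {A c t : ℝ} (hA : 0 < A) : Real.sqrt A * (c * (Real.sqrt A⁻¹ * t)) = c * t := by
  have h : Real.sqrt A * Real.sqrt A⁻¹ = 1 := by
    rw [← Real.sqrt_mul hA.le, mul_inv_cancel₀ hA.ne', Real.sqrt_one]
  calc Real.sqrt A * (c * (Real.sqrt A⁻¹ * t)) = (Real.sqrt A * Real.sqrt A⁻¹) * (c * t) := by ring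
    _ = c * t := by rw [h, one_mul]

/-- **THE `(S₁, S₂, ρ)` DISPLAY INHABITED, VOLUME-FREE**: for level bond variables `ε_j`-close to `1` in `U1` with
`ρ̂ := Π_{j≤n}(1 + 2M_φM_φ′ε_j)^{d(L−1)} − 1 < 1` there are right inverses `S₁` of `Q′_{n+1}(1)` and `S₂` of `Q′_{n+1}(U)`,
`(T_m → W) →ₗ[ℂ] L²(T_{L^{n+1}m}; c₀; W)`, with `0 ≤ ρ̂(1−ρ̂)⁻¹` and BOTH letters `‖S₁(Q′(1)λ − Q′(U)λ)‖ ≤ ρ̂(1−ρ̂)⁻¹‖λ‖`, `‖S₂(Q′(U)λ − Q′(1)λ)‖ ≤ ρ̂(1−ρ̂)⁻¹‖λ‖`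
(in fact `≤ ρ̂‖λ‖` for the first).  `S₁` = the block-constant flat section, `S₂` = the Neumann section; `√(c₀L^{kd})·√((c₀L^{kd})⁻¹) = 1`.
[cite: Balaban1985BackgroundPropagators, (3.19) p.393, p.403, (3.79)–(3.81) p.406, (3.11) p.392] -/
theorem exists_sections_L2 {Mφ Mφ' : ℝ} (hMφ : 0 ≤ Mφ) (hMφ' : 0 ≤ Mφ') (hφ : ∀ w, ‖φ w‖ ≤ Mφ * ‖w‖) (hφ' : ∀ X, ‖φ.symm X‖ ≤ Mφ' * ‖X‖)
    (U : Bond d (towerP L m (n + 1)) → 𝔸ˣ) (εU : ℕ → ℝ) (hεU : ∀ j, 0 ≤ εU j)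
    (hUε : ∀ (j : ℕ) (b : Bond d (towerP L m (j + 1))), ‖(UlevOf L m (n + 1) U j b : 𝔸) - 1‖ ≤ εU j)
    (hUb : ∀ (j : ℕ) (b : Bond d (towerP L m (j + 1))), UlevOf L m (n + 1) U j b ∈ U1 𝔸)
    (hρ : (∏ j ∈ Finset.range (n + 1), (1 + 2 * Mφ * Mφ' * εU j) ^ (d * (L - 1))) - 1 < 1) :
    ∃ S₁ S₂ : (TSite d m → W) →ₗ[ℂ] SiteL2K ℂ d (towerP L m (n + 1)) c₀ W,
      0 ≤ ((∏ j ∈ Finset.range (n + 1), (1 + 2 * Mφ * Mφ' * εU j) ^ (d * (L - 1))) - 1) *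
          (1 - ((∏ j ∈ Finset.range (n + 1), (1 + 2 * Mφ * Mφ' * εU j) ^ (d * (L - 1))) - 1))⁻¹ ∧
      (∀ f, QprimeTowerW L m n φ (fun _ : Bond d (towerP L m (n + 1)) => (1 : 𝔸ˣ)) (c₀ := c₀) (S₁ f) = f) ∧
      (∀ f, QprimeTowerW L m n φ U (c₀ := c₀) (S₂ f) = f) ∧
      (∀ l : SiteL2K ℂ d (towerP L m (n + 1)) c₀ W,
        ‖S₁ (QprimeTowerW L m n φ (fun _ : Bond d (towerP L m (n + 1)) => (1 : 𝔸ˣ)) l - QprimeTowerW L m n φ U l)‖ ≤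
          ((∏ j ∈ Finset.range (n + 1), (1 + 2 * Mφ * Mφ' * εU j) ^ (d * (L - 1))) - 1) *
            (1 - ((∏ j ∈ Finset.range (n + 1), (1 + 2 * Mφ * Mφ' * εU j) ^ (d * (L - 1))) - 1))⁻¹ * ‖l‖) ∧
      ∀ l : SiteL2K ℂ d (towerP L m (n + 1)) c₀ W,
        ‖S₂ (QprimeTowerW L m n φ U l - QprimeTowerW L m n φ (fun _ : Bond d (towerP L m (n + 1)) => (1 : 𝔸ˣ)) l)‖ ≤
          ((∏ j ∈ Finset.range (n + 1), (1 + 2 * Mφ * Mφ' * εU j) ^ (d * (L - 1))) - 1) *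
            (1 - ((∏ j ∈ Finset.range (n + 1), (1 + 2 * Mφ * Mφ' * εU j) ^ (d * (L - 1))) - 1))⁻¹ * ‖l‖ := by
  have hc₀ : 0 < c₀ := Fact.out
  have hL0 : (0 : ℝ) < L := by exact_mod_cast Nat.pos_of_ne_zero (NeZero.ne L)
  set ρh : ℝ := (∏ j ∈ Finset.range (n + 1), (1 + 2 * Mφ * Mφ' * εU j) ^ (d * (L - 1))) - 1 with hρhdef
  have hρh0 : 0 ≤ ρh := by
    rw [hρhdef, sub_nonneg]
    exact Finset.one_le_prod (s := Finset.range (n + 1)) fun j _ => one_le_pow₀ (by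
      have h0 : 0 ≤ 2 * Mφ * Mφ' * εU j := by have := hεU j; positivity
      linarith)
  have h1ρ : 0 < 1 - ρh := by linarith
  have hρ'0 : 0 ≤ ρh * (1 - ρh)⁻¹ := mul_nonneg hρh0 (inv_nonneg.mpr h1ρ.le)
  have hρle : ρh ≤ ρh * (1 - ρh)⁻¹ := by
    have h1 : 1 ≤ (1 - ρh)⁻¹ := by rw [one_le_inv₀ h1ρ]; linarith
    calc ρh = ρh * 1 := (mul_one _).symm
      _ ≤ ρh * (1 - ρh)⁻¹ := mul_le_mul_of_nonneg_left h1 hρh0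
  set A : ℝ := c₀ * ((L : ℝ) ^ (n + 1)) ^ d with hAdef
  have hA : 0 < A := by rw [hAdef]; positivity
  -- the two sections
  obtain ⟨S₁, hS₁, hS₁mass, -⟩ := exists_QprimeTowerW_one_flatSection L (𝔸 := 𝔸) m n (W := W) (c₀ := c₀)
  obtain ⟨S₂, hS₂, hS₂norm⟩ :=
    exists_QprimeTowerW_section_of_small L m n φ hMφ hMφ' hφ hφ' (c₀ := c₀) U εU hεU hUε hUb hρ
  have hS₁norm : ∀ h : TSite d m → W, ‖S₁ h‖ = Real.sqrt A * Real.sqrt (∑ y, ‖h y‖ ^ 2) := fun h => by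
    have h2 := hS₁mass h
    rw [hAdef, ← Real.sqrt_mul (by positivity), ← h2, Real.sqrt_sq (norm_nonneg _)]
  -- the `ℓ²` tower letter, both orientations of the difference
  have hT : ∀ l : SiteL2K ℂ d (towerP L m (n + 1)) c₀ W,
      Real.sqrt (∑ y : TSite d m, ‖(QprimeTowerW L m n φ U (c₀ := c₀) l -
        QprimeTowerW L m n φ (fun _ : Bond d (towerP L m (n + 1)) => (1 : 𝔸ˣ)) (c₀ := c₀) l) y‖ ^ 2) ≤ ρh * (Real.sqrt A⁻¹ * ‖l‖) := fun l => by
    have h := sqrt_sum_norm_sq_QprimeTowerW_sub_flat_le L m n φ hMφ hMφ' hφ hφ' (c₀ := c₀) U εU hεU hUε hUb l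
    simpa only [Pi.sub_apply, hρhdef, hAdef] using h
  have hT' : ∀ l : SiteL2K ℂ d (towerP L m (n + 1)) c₀ W,
      Real.sqrt (∑ y : TSite d m, ‖(QprimeTowerW L m n φ (fun _ : Bond d (towerP L m (n + 1)) => (1 : 𝔸ˣ)) (c₀ := c₀) l -
        QprimeTowerW L m n φ U (c₀ := c₀) l) y‖ ^ 2) ≤ ρh * (Real.sqrt A⁻¹ * ‖l‖) := fun l => by
    have h := hT l
    have e : ∀ y : TSite d m, ‖(QprimeTowerW L m n φ (fun _ : Bond d (towerP L m (n + 1)) => (1 : 𝔸ˣ)) (c₀ := c₀) l -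
        QprimeTowerW L m n φ U (c₀ := c₀) l) y‖ = ‖(QprimeTowerW L m n φ U (c₀ := c₀) l -
        QprimeTowerW L m n φ (fun _ : Bond d (towerP L m (n + 1)) => (1 : 𝔸ˣ)) (c₀ := c₀) l) y‖ := fun y => by
      simp only [Pi.sub_apply]; exact norm_sub_rev _ _
    simp only [e]; exact h
  refine ⟨S₁, S₂, hρ'0, hS₁ φ, hS₂, fun l => ?_, fun l => ?_⟩
  · -- letter 1: `‖S₁(Q′(1)l − Q′(U)l)‖ = √A·√Σ ≤ ρ̂‖l‖ ≤ ρ‖l‖`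
    rw [hS₁norm]
    calc Real.sqrt A * Real.sqrt (∑ y : TSite d m, ‖(QprimeTowerW L m n φ (fun _ : Bond d (towerP L m (n + 1)) => (1 : 𝔸ˣ)) (c₀ := c₀) l -
          QprimeTowerW L m n φ U (c₀ := c₀) l) y‖ ^ 2)
        ≤ Real.sqrt A * (ρh * (Real.sqrt A⁻¹ * ‖l‖)) := mul_le_mul_of_nonneg_left (hT' l) (Real.sqrt_nonneg _)
      _ = ρh * ‖l‖ := sqrt_mul_sqrt_inv_mul hA
      _ ≤ ρh * (1 - ρh)⁻¹ * ‖l‖ := mul_le_mul_of_nonneg_right hρle (norm_nonneg _)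
  · -- letter 2: `‖S₂(Q′(U)l − Q′(1)l)‖ ≤ √A(1−ρ̂)⁻¹√Σ ≤ ρ‖l‖`
    refine (hS₂norm _).trans ?_
    calc Real.sqrt A * (1 - ρh)⁻¹ * Real.sqrt (∑ y : TSite d m, ‖(QprimeTowerW L m n φ U (c₀ := c₀) l -
          QprimeTowerW L m n φ (fun _ : Bond d (towerP L m (n + 1)) => (1 : 𝔸ˣ)) (c₀ := c₀) l) y‖ ^ 2)
        ≤ Real.sqrt A * (1 - ρh)⁻¹ * (ρh * (Real.sqrt A⁻¹ * ‖l‖)) := mul_le_mul_of_nonneg_left (hT l) (by positivity)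
      _ = (1 - ρh)⁻¹ * (Real.sqrt A * (ρh * (Real.sqrt A⁻¹ * ‖l‖))) := by ring
      _ = (1 - ρh)⁻¹ * (ρh * ‖l‖) := by rw [sqrt_mul_sqrt_inv_mul hA]
      _ = ρh * (1 - ρh)⁻¹ * ‖l‖ := by ring

end Sections

/-! ## §1 [B9] Thm 3.11's second half at `k` levels, the sections discharged: `∃ γ ε₀ > 0` (the host's) -/

section SmallField

variable (α : ℕ → ℝ) (hα1 : ∀ j, α j ≤ 1 / 64)

/-- **[B9] THM 3.11, SECOND HALF, AT `k = n+1` LEVELS — THE SECTIONS OF `Q′_k` DISCHARGED, VOLUME-FREE**: the host's `γ, ε₀`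
(`B9Thm311SmallFieldCoercivityTowerL2.exists_coercive_principalk_of_small_field_L2`, unchanged); for EVERY background `U` of the tower's data whose
level bond variables are `ε_j`-close to `1` in `U1` with `ρ̂ := Π_{j≤n}(1 + 2M_φM_φ′ε_j)^{d(L−1)} − 1 < 1`, unit-bounded `ε`-small fine bond variables,
`hRS`, the `Q`-letter `‖Q_k(U)x − Q_k(1)x‖ ≤ δ_Q‖x‖` and `ε + ρ̂(1−ρ̂)⁻¹ + δ_Q ≤ ε₀`:
`γ‖x‖² ≤ re⟨x, (D*D + DR_k(U)D* + aQ_k(U)†Q_k(U))x⟩` — `S₁, S₂` and both `L²` letters supplied by `exists_sections_L2`.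
[cite: Balaban1985BackgroundPropagators, Thm 3.11 p.416, (3.82)–(3.86) p.407, (3.19) p.393, (3.15) p.393] -/
theorem exists_coercive_principalk_of_small_field_L2_sections {η : ℝ} (hη : η ≠ 0) {a : ℝ} (ha : 0 < a) {Mφ Mφ' : ℝ} (hMφ : 0 ≤ Mφ)
    (hMφ' : 0 ≤ Mφ') (hφ : ∀ w, ‖φ w‖ ≤ Mφ * ‖w‖) (hφ' : ∀ X, ‖φ.symm X‖ ≤ Mφ' * ‖X‖) :
    ∃ γ ε₀ : ℝ, 0 < γ ∧ 0 < ε₀ ∧ ∀ (U : Bond d (towerP L m (n + 1)) → 𝔸ˣ)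
      (hU1 : ∀ (j : ℕ) (x : B7Prop1Explicit.Site d) (κ : Fin d), perCfg (towerP L m (j + 1)) (UlevOf L m (n + 1) U j) x κ ∈ U1 𝔸)
      (hreg : ∀ (j : ℕ) (y : TSite d (towerP L m j)) (κ : Fin d) (r : Fin d → Fin L),
        ‖((Wcx L (perCfg (towerP L m (j + 1)) (UlevOf L m (n + 1) U j)) (cornerSite L y) κ (boxVec L r) : 𝔸ˣ) : 𝔸) - 1‖ ≤ α j)
      (εU : ℕ → ℝ), (∀ j, 0 ≤ εU j) →
      (∀ (j : ℕ) (b : Bond d (towerP L m (j + 1))), ‖(UlevOf L m (n + 1) U j b : 𝔸) - 1‖ ≤ εU j) →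
      (∀ (j : ℕ) (b : Bond d (towerP L m (j + 1))), UlevOf L m (n + 1) U j b ∈ U1 𝔸) →
      (∏ j ∈ Finset.range (n + 1), (1 + 2 * Mφ * Mφ' * εU j) ^ (d * (L - 1))) - 1 < 1 →
      ∀ {ε δQ : ℝ}, 0 ≤ ε → 0 ≤ δQ →
      ε + ((∏ j ∈ Finset.range (n + 1), (1 + 2 * Mφ * Mφ' * εU j) ^ (d * (L - 1))) - 1) *
          (1 - ((∏ j ∈ Finset.range (n + 1), (1 + 2 * Mφ * Mφ' * εU j) ^ (d * (L - 1))) - 1))⁻¹ + δQ ≤ ε₀ →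
      (∀ b, U b ∈ U1 𝔸) → (∀ b, ‖(U b : 𝔸) - 1‖ ≤ ε) →
      (∀ (b : Bond d (towerP L m (n + 1))) (v u : W), ⟪adTransportW φ U b v, u⟫_ℂ = ⟪v, adTransportW φ (fun b => (U b)⁻¹) b u⟫_ℂ) →
      (∀ x : BondL2K ℂ d (towerP L m (n + 1)) c₀ W, ‖QkW L m n φ U hL α hα1 hU1 hreg (c₁ := c₁) x -
        QkW L m n φ (fun _ : Bond d (towerP L m (n + 1)) => (1 : 𝔸ˣ)) hL (fun _ => 0) (fun _ => by norm_num)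
          (perCfg_UlevOf_one_mem_U1 L m (n + 1)) (norm_Wcx_UlevOf_one_sub_one_le L m (n + 1) (fun _ => 0) (fun _ => le_rfl)) (c₁ := c₁) x‖ ≤
        δQ * ‖x‖) →
      ∀ x : BondL2K ℂ d (towerP L m (n + 1)) c₀ W, γ * ‖x‖ ^ 2 ≤
        RCLike.re ⟪x, laplaceALatticeK ((η : ℂ))⁻¹ (adTransportW φ U) (adTransportW φ fun b => (U b)⁻¹) (principalOpK φ η U) (RofUk L m n φ η U)
          (QkW L m n φ U hL α hα1 hU1 hreg (c₁ := c₁)) a x⟫_ℂ := by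
  obtain ⟨γ, ε₀, hγ, hε₀, H⟩ :=
    exists_coercive_principalk_of_small_field_L2 L m n hL φ (c₀ := c₀) (c₁ := c₁) α hα1 hη ha hMφ hMφ' hφ hφ'
  refine ⟨γ, ε₀, hγ, hε₀, ?_⟩
  intro U hU1 hreg εU hεU hUε hUb hρ1 ε δQ hε hδQ ht hUb' hUε' hRS hQ x
  obtain ⟨S₁, S₂, hρ'0, hS₁, hS₂, hρ₁, hρ₂⟩ := exists_sections_L2 L m n φ (c₀ := c₀) hMφ hMφ' hφ hφ' U εU hεU hUε hUb hρ1
  exact H U hU1 hreg S₁ S₂ hε hρ'0 hδQ ht hUb' hUε' hRS hS₁ hS₂ hρ₁ hρ₂ hQ x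

end SmallField

/-! ## §2 [B9] Thm 3.11 for the `k`-level operator `Δ_a(U)` (with the curvature part), the sections discharged -/

section Hpos

variable [StarRing 𝔸] [NormedStarGroup 𝔸] [StarModule ℂ 𝔸] (α : ℕ → ℝ) (hα1 : ∀ j, α j ≤ 1 / 64)

/-- **[B9] THM 3.11 «Δ_a IS POSITIVE DEFINITE» FOR THE `k`-LEVEL OPERATOR `laplaceAk` AT EVERY SMALL FIELD OF A FIXED LATTICE — THE SECTIONS OF
`Q′_k` DISCHARGED**: the host's `ε₀` (`laplaceAk_pos_of_small_field_L2`, unchanged); for EVERY `U` of the tower's data with level bond variables `ε_j`-close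
to `1` in `U1`, `ρ̂ < 1`, `U(b) ∈ U1`, `‖U(b) − 1‖ ≤ ε`, `hRS`, the `Q`-letter and `ε + ρ̂(1−ρ̂)⁻¹ + δ_Q ≤ ε₀`: `0 < re⟨x, Δ_a^{(k)}(U)x⟩` for `x ≠ 0` —
the DISPLAYED `hpos` of `B9Eq326OperatorTower.G1k ∕ H1k ∕ frakGk` with NO section and NO coarse volume left in it.  NOT print's uniform statement.
[cite: Balaban1985BackgroundPropagators, Thm 3.11 p.416, (3.69) p.404, (3.82)–(3.86) p.407, (3.19) p.393] -/
theorem laplaceAk_pos_of_small_field_L2_sections {η : ℝ} (hη : η ≠ 0) {a : ℝ} (ha : 0 < a) {Mφ Mφ' : ℝ} (hMφ : 0 ≤ Mφ) (hMφ' : 0 ≤ Mφ')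
    (hφ : ∀ w, ‖φ w‖ ≤ Mφ * ‖w‖) (hφ' : ∀ X, ‖φ.symm X‖ ≤ Mφ' * ‖X‖) (τ : 𝔸 →ₗ[ℂ] ℂ) {Cτ : ℝ} (hτ : ∀ X, ‖τ X‖ ≤ Cτ * ‖X‖) (hCτ : 0 ≤ Cτ) :
    ∃ ε₀ : ℝ, 0 < ε₀ ∧ ∀ (U : Bond d (towerP L m (n + 1)) → 𝔸ˣ)
      (hU1 : ∀ (j : ℕ) (x : B7Prop1Explicit.Site d) (κ : Fin d), perCfg (towerP L m (j + 1)) (UlevOf L m (n + 1) U j) x κ ∈ U1 𝔸)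
      (hreg : ∀ (j : ℕ) (y : TSite d (towerP L m j)) (κ : Fin d) (r : Fin d → Fin L),
        ‖((Wcx L (perCfg (towerP L m (j + 1)) (UlevOf L m (n + 1) U j)) (cornerSite L y) κ (boxVec L r) : 𝔸ˣ) : 𝔸) - 1‖ ≤ α j)
      (εU : ℕ → ℝ), (∀ j, 0 ≤ εU j) →
      (∀ (j : ℕ) (b : Bond d (towerP L m (j + 1))), ‖(UlevOf L m (n + 1) U j b : 𝔸) - 1‖ ≤ εU j) →
      (∀ (j : ℕ) (b : Bond d (towerP L m (j + 1))), UlevOf L m (n + 1) U j b ∈ U1 𝔸) →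
      (∏ j ∈ Finset.range (n + 1), (1 + 2 * Mφ * Mφ' * εU j) ^ (d * (L - 1))) - 1 < 1 →
      ∀ {ε δQ : ℝ}, 0 ≤ ε → 0 ≤ δQ →
      ε + ((∏ j ∈ Finset.range (n + 1), (1 + 2 * Mφ * Mφ' * εU j) ^ (d * (L - 1))) - 1) *
          (1 - ((∏ j ∈ Finset.range (n + 1), (1 + 2 * Mφ * Mφ' * εU j) ^ (d * (L - 1))) - 1))⁻¹ + δQ ≤ ε₀ →
      (∀ b, U b ∈ U1 𝔸) → (∀ b, ‖(U b : 𝔸) - 1‖ ≤ ε) →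
      (∀ (b : Bond d (towerP L m (n + 1))) (v u : W), ⟪adTransportW φ U b v, u⟫_ℂ = ⟪v, adTransportW φ (fun b => (U b)⁻¹) b u⟫_ℂ) →
      (∀ x : BondL2K ℂ d (towerP L m (n + 1)) c₀ W, ‖QkW L m n φ U hL α hα1 hU1 hreg (c₁ := c₁) x -
        QkW L m n φ (fun _ : Bond d (towerP L m (n + 1)) => (1 : 𝔸ˣ)) hL (fun _ => 0) (fun _ => by norm_num)
          (perCfg_UlevOf_one_mem_U1 L m (n + 1)) (norm_Wcx_UlevOf_one_sub_one_le L m (n + 1) (fun _ => 0) (fun _ => le_rfl)) (c₁ := c₁) x‖ ≤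
        δQ * ‖x‖) →
      ∀ x : BondL2K ℂ d (towerP L m (n + 1)) c₀ W, x ≠ 0 →
        0 < RCLike.re ⟪x, laplaceAk L m n φ η U hL α hα1 hU1 hreg τ (c₀ := c₀) (c₁ := c₁) a x⟫_ℂ := by
  obtain ⟨ε₀, hε₀, H⟩ :=
    laplaceAk_pos_of_small_field_L2 L m n hL φ (c₀ := c₀) (c₁ := c₁) α hα1 hη ha hMφ hMφ' hφ hφ' τ hτ hCτ
  refine ⟨ε₀, hε₀, ?_⟩
  intro U hU1 hreg εU hεU hUε hUb hρ1 ε δQ hε hδQ ht hUb' hUε' hRS hQ x hx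
  obtain ⟨S₁, S₂, hρ'0, hS₁, hS₂, hρ₁, hρ₂⟩ := exists_sections_L2 L m n φ (c₀ := c₀) hMφ hMφ' hφ hφ' U εU hεU hUε hUb hρ1
  exact H U hU1 hreg S₁ S₂ hε hρ'0 hδQ ht hUb' hUε' hRS hS₁ hS₂ hρ₁ hρ₂ hQ x hx

/-- **THE SAME WITH `hRS` DISCHARGED BY THE MODEL LETTERS** (unitary bond variables, a tracial `τ` norming the fibre — the host's
`laplaceAk_pos_of_small_field_unitary_L2`), the sections discharged. [cite: Balaban1985BackgroundPropagators, Thm 3.11 p.416, (3.5) p.391, (3.19) p.393] -/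
theorem laplaceAk_pos_of_small_field_unitary_L2_sections {η : ℝ} (hη : η ≠ 0) {a : ℝ} (ha : 0 < a) {Mφ Mφ' : ℝ} (hMφ : 0 ≤ Mφ)
    (hMφ' : 0 ≤ Mφ') (hφ : ∀ w, ‖φ w‖ ≤ Mφ * ‖w‖) (hφ' : ∀ X, ‖φ.symm X‖ ≤ Mφ' * ‖X‖) (τ : 𝔸 →ₗ[ℂ] ℂ) {Cτ : ℝ}
    (hτ : ∀ X, ‖τ X‖ ≤ Cτ * ‖X‖) (hCτ : 0 ≤ Cτ) (hτφ : ∀ X Y : 𝔸, ⟪φ.symm X, φ.symm Y⟫_ℂ = τ (star X * Y))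
    (htr : ∀ X Y : 𝔸, τ (X * Y) = τ (Y * X)) :
    ∃ ε₀ : ℝ, 0 < ε₀ ∧ ∀ (U : Bond d (towerP L m (n + 1)) → 𝔸ˣ)
      (hU1 : ∀ (j : ℕ) (x : B7Prop1Explicit.Site d) (κ : Fin d), perCfg (towerP L m (j + 1)) (UlevOf L m (n + 1) U j) x κ ∈ U1 𝔸)
      (hreg : ∀ (j : ℕ) (y : TSite d (towerP L m j)) (κ : Fin d) (r : Fin d → Fin L),
        ‖((Wcx L (perCfg (towerP L m (j + 1)) (UlevOf L m (n + 1) U j)) (cornerSite L y) κ (boxVec L r) : 𝔸ˣ) : 𝔸) - 1‖ ≤ α j)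
      (εU : ℕ → ℝ), (∀ j, 0 ≤ εU j) →
      (∀ (j : ℕ) (b : Bond d (towerP L m (j + 1))), ‖(UlevOf L m (n + 1) U j b : 𝔸) - 1‖ ≤ εU j) →
      (∀ (j : ℕ) (b : Bond d (towerP L m (j + 1))), UlevOf L m (n + 1) U j b ∈ U1 𝔸) →
      (∏ j ∈ Finset.range (n + 1), (1 + 2 * Mφ * Mφ' * εU j) ^ (d * (L - 1))) - 1 < 1 →
      ∀ {ε δQ : ℝ}, 0 ≤ ε → 0 ≤ δQ →
      ε + ((∏ j ∈ Finset.range (n + 1), (1 + 2 * Mφ * Mφ' * εU j) ^ (d * (L - 1))) - 1) *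
          (1 - ((∏ j ∈ Finset.range (n + 1), (1 + 2 * Mφ * Mφ' * εU j) ^ (d * (L - 1))) - 1))⁻¹ + δQ ≤ ε₀ →
      (∀ b, U b ∈ U1 𝔸) → (∀ b, ‖(U b : 𝔸) - 1‖ ≤ ε) → (∀ b, star (U b : 𝔸) = (((U b)⁻¹ : 𝔸ˣ) : 𝔸)) →
      (∀ x : BondL2K ℂ d (towerP L m (n + 1)) c₀ W, ‖QkW L m n φ U hL α hα1 hU1 hreg (c₁ := c₁) x -
        QkW L m n φ (fun _ : Bond d (towerP L m (n + 1)) => (1 : 𝔸ˣ)) hL (fun _ => 0) (fun _ => by norm_num)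
          (perCfg_UlevOf_one_mem_U1 L m (n + 1)) (norm_Wcx_UlevOf_one_sub_one_le L m (n + 1) (fun _ => 0) (fun _ => le_rfl)) (c₁ := c₁) x‖ ≤
        δQ * ‖x‖) →
      ∀ x : BondL2K ℂ d (towerP L m (n + 1)) c₀ W, x ≠ 0 →
        0 < RCLike.re ⟪x, laplaceAk L m n φ η U hL α hα1 hU1 hreg τ (c₀ := c₀) (c₁ := c₁) a x⟫_ℂ := by
  obtain ⟨ε₀, hε₀, H⟩ :=
    laplaceAk_pos_of_small_field_unitary_L2 L m n hL φ (c₀ := c₀) (c₁ := c₁) α hα1 hη ha hMφ hMφ' hφ hφ' τ hτ hCτ hτφ htr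
  refine ⟨ε₀, hε₀, ?_⟩
  intro U hU1 hreg εU hεU hUε hUb hρ1 ε δQ hε hδQ ht hUb' hUε' hUstar hQ x hx
  obtain ⟨S₁, S₂, hρ'0, hS₁, hS₂, hρ₁, hρ₂⟩ := exists_sections_L2 L m n φ (c₀ := c₀) hMφ hMφ' hφ hφ' U εU hεU hUε hUb hρ1
  exact H U hU1 hreg S₁ S₂ hε hρ'0 hδQ ht hUb' hUε' hUstar hS₁ hS₂ hρ₁ hρ₂ hQ x hx

end Hpos

end Literature.MathematicalPhysics.QuantumFieldTheory.Balaban1983to89.B9Thm311SmallFieldCoercivityTowerL2Sections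

end
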